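import Summits.Ventures.PercRepro.C041TriDomLeafMark

/-!
# ROW C-041 — THEOREM (LEAF MARK), STATUS FORM: A MARK WHOSE DOUBLE-COMPONENT MEETS AT MOST ONE FREE EDGE
(p6, gen 50; P6-TWOEXIT-LEAN.md §53 ADDENDUM 24 cont. 2)

The double-component `X = dblCompS Z₁ st x` of the anchor (the vertices reached through double edges) is
connected to `x` in both colours, so a crossed colouring with `x` as the shared mark — red `x ~ y`, blue `x ~ z` —
needs `y, z ∉ X` and a red edge and a blue edge LEAVING `X` (`exit_red`, `exit_blue`: the first step of a walk out of
`X`); an edge leaving `X` is not double (`X` is closed under double adjacency, `mem_dblComp_of_double`), so under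
`LeafCompS` — every edge touching `X` other than `f` is absent or double, and `f` is not double — both are `f`,
which cannot be red and blue at once (`not_C12S_of_leafCompS`).  COROLLARY (TWO CLASSES) does the rest
(`cycDominationS_of_leafCompS`, the exits by rotation).  This is literally the hypothesis of the first base case of
the rebalancing hierarchy (ADDENDUM 23 cont. 5: «no free edge at `X` besides the split edge»), and `LeafS` is the
special case without double edges at `x` (`leafCompS_of_leafS`).
-/

namespace PercRepro

namespace ZoneZ

namespace MultiExit

open ZoneData Finset

variable {V₁ E₁ U₁ U₂ : Type} (Z₁ : ZoneData V₁ E₁ U₁ U₂) (st : E₁ → EStat) (x y z : V₁)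

/-! ## The double-component as a leaf -/

/-- Every edge touching the double-component of `x` other than `f` is absent or double, and `f` is not double. -/
def LeafCompS (f : E₁) : Prop :=
  st f ≠ EStat.double ∧ ∀ e, (Z₁.fst e ∈ dblCompS Z₁ st x ∨ Z₁.snd e ∈ dblCompS Z₁ st x) → e ≠ f →
    st e = EStat.absent ∨ st e = EStat.double

/-- The double-component is closed under double edges. -/
theorem mem_dblComp_of_double {a b : V₁} (ha : a ∈ dblCompS Z₁ st x) {e : E₁} (he : Z₁.Joins e a b)
    (hd : st e = EStat.double) : b ∈ dblCompS Z₁ st x := by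
  unfold dblCompS at ha ⊢
  exact reach_trans' ha ((mem_reach_singleton _ _ _).mpr (Relation.ReflTransGen.single ⟨e, he, hd⟩))

/-- A walk from `x` to a vertex off `X` takes a step from `X` to its complement. -/
theorem exit_of_rtg {R : V₁ → V₁ → Prop} {w : V₁} (h : Relation.ReflTransGen R x w) :
    w ∈ dblCompS Z₁ st x ∨ ∃ a b, a ∈ dblCompS Z₁ st x ∧ b ∉ dblCompS Z₁ st x ∧ R a b := by
  induction h with
  | refl => exact Or.inl (mem_reach_self _ _)
  | @tail w w' _ hww' ih =>
    rcases ih with hw | hw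
    · by_cases hw' : w' ∈ dblCompS Z₁ st x
      · exact Or.inl hw'
      · exact Or.inr ⟨w, w', hw, hw', hww'⟩
    · exact Or.inr hw

/-- A red walk from `x` to a vertex off `X` uses a red edge leaving `X`. -/
theorem exit_red (ω : E₁ → Bool) {v : V₁} (hv : v ∉ dblCompS Z₁ st x) (h : RdS Z₁ st ω x v) :
    ∃ e a b, a ∈ dblCompS Z₁ st x ∧ b ∉ dblCompS Z₁ st x ∧ Z₁.Joins e a b ∧ redE st ω e := by
  unfold RdS at h
  rw [mem_reach_singleton] at h
  rcases exit_of_rtg Z₁ st x h with h | ⟨a, b, ha, hb, e, he, hr⟩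
  · exact absurd h hv
  · exact ⟨e, a, b, ha, hb, he, hr⟩

/-- A blue walk from `x` to a vertex off `X` uses a blue edge leaving `X`. -/
theorem exit_blue (ω : E₁ → Bool) {v : V₁} (hv : v ∉ dblCompS Z₁ st x) (h : MgS Z₁ st ω x v) :
    ∃ e a b, a ∈ dblCompS Z₁ st x ∧ b ∉ dblCompS Z₁ st x ∧ Z₁.Joins e a b ∧ blueE st ω e := by
  unfold MgS at h
  rw [mem_reach_singleton] at h
  rcases exit_of_rtg Z₁ st x h with h | ⟨a, b, ha, hb, e, he, hb'⟩
  · exact absurd h hv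
  · exact ⟨e, a, b, ha, hb, he, hb'⟩

/-- Under `LeafCompS`, a red edge leaving `X` is `f`, red. -/
theorem leafCompS_red {f : E₁} (hl : LeafCompS Z₁ st x f) (ω : E₁ → Bool) {e : E₁} {a b : V₁}
    (ha : a ∈ dblCompS Z₁ st x) (hb : b ∉ dblCompS Z₁ st x) (he : Z₁.Joins e a b) (hr : redE st ω e) :
    ω f = true := by
  have hnd : st e ≠ EStat.double := fun hd => hb (mem_dblComp_of_double Z₁ st x ha he hd)
  by_cases hef : e = f
  · subst hef
    rcases hr with hr | ⟨_, hr⟩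
    · exact absurd hr hnd
    · exact hr
  · have ht : Z₁.fst e ∈ dblCompS Z₁ st x ∨ Z₁.snd e ∈ dblCompS Z₁ st x := by
      rcases he with ⟨h1, _⟩ | ⟨_, h2⟩
      · exact Or.inl (h1 ▸ ha)
      · exact Or.inr (h2 ▸ ha)
    rcases hl.2 e ht hef with h | h
    · rcases hr with hr | ⟨hr, _⟩ <;> simp [h] at hr
    · exact absurd h hnd

/-- Under `LeafCompS`, a blue edge leaving `X` is `f`, blue. -/
theorem leafCompS_blue {f : E₁} (hl : LeafCompS Z₁ st x f) (ω : E₁ → Bool) {e : E₁} {a b : V₁}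
    (ha : a ∈ dblCompS Z₁ st x) (hb : b ∉ dblCompS Z₁ st x) (he : Z₁.Joins e a b) (hbl : blueE st ω e) :
    ω f = false := by
  have hnd : st e ≠ EStat.double := fun hd => hb (mem_dblComp_of_double Z₁ st x ha he hd)
  by_cases hef : e = f
  · subst hef
    rcases hbl with hbl | ⟨_, hbl⟩
    · exact absurd hbl hnd
    · exact hbl
  · have ht : Z₁.fst e ∈ dblCompS Z₁ st x ∨ Z₁.snd e ∈ dblCompS Z₁ st x := by
      rcases he with ⟨h1, _⟩ | ⟨_, h2⟩
      · exact Or.inl (h1 ▸ ha)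
      · exact Or.inr (h2 ▸ ha)
    rcases hl.2 e ht hef with h | h
    · rcases hbl with hbl | ⟨hbl, _⟩ <;> simp [h] at hbl
    · exact absurd h hnd

/-- **The anchor of a leaf component is never the shared mark of a crossed colouring.** -/
theorem not_C12S_of_leafCompS {f : E₁} (hl : LeafCompS Z₁ st x f) (ω : E₁ → Bool) :
    ¬ C12S Z₁ st x y z ω := by
  rintro ⟨⟨hxy, hxz, _⟩, ⟨hmxy, hmxz, _⟩⟩
  have hy : y ∉ dblCompS Z₁ st x := fun h => hmxy (MgS_of_mem_dblComp Z₁ st ω h)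
  have hz : z ∉ dblCompS Z₁ st x := fun h => hxz (RdS_of_mem_dblComp Z₁ st ω h)
  obtain ⟨e, a, b, ha, hb, he, hr⟩ := exit_red Z₁ st x ω hy hxy
  obtain ⟨e', a', b', ha', hb', he', hbl⟩ := exit_blue Z₁ st x ω hz hmxz
  have h1 := leafCompS_red Z₁ st x hl ω ha hb he hr
  have h2 := leafCompS_blue Z₁ st x hl ω ha' hb' he' hbl
  rw [h1] at h2
  exact Bool.noConfusion h2

section Counting

variable [Fintype E₁] [DecidableEq E₁]

open Classical in
/-- **THEOREM (LEAF MARK, STATUS FORM)**: if every edge touching the double-component of the anchor, other than one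
non-double edge `f`, is absent or double, CONJECTURE (STOCHASTIC DOMINATION) holds on every up-set of the status. -/
theorem cycDominationS_of_leafCompS {f : E₁} (hl : LeafCompS Z₁ st x f) : CycDominationS Z₁ x y z st := by
  intro V hV
  refine le_of_eq_of_le (card_filter_congr' fun ω _ => and_congr_right fun _ => ?_)
    (pair23_31_le_topBotS Z₁ st x y z hV)
  rw [cycCrossedS_iff_classes]
  constructor
  · rintro (h | h | h)
    · exact absurd h (not_C12S_of_leafCompS Z₁ st x y z hl ω)
    · exact Or.inl h
    · exact Or.inr h
  · rintro (h | h)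
    · exact Or.inr (Or.inl h)
    · exact Or.inr (Or.inr h)

open Classical in
/-- The status form at the first exit. -/
theorem cycDominationS_of_leafCompS_exit {f : E₁} (hl : LeafCompS Z₁ st y f) : CycDominationS Z₁ x y z st :=
  (cycDominationS_rot Z₁ st x y z).mpr (cycDominationS_of_leafCompS Z₁ st y z x hl)

open Classical in
/-- The status form at the second exit. -/
theorem cycDominationS_of_leafCompS_exit' {f : E₁} (hl : LeafCompS Z₁ st z f) : CycDominationS Z₁ x y z st :=
  (cycDominationS_rot Z₁ st x y z).mpr
    ((cycDominationS_rot Z₁ st y z x).mpr (cycDominationS_of_leafCompS Z₁ st z x y hl))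

end Counting

/-! ## `LeafS` is the special case without double edges at the mark -/

/-- Under `LeafS`, the double-component of `x` is `{x}`: a double edge at `x` would be absent. -/
theorem dblComp_eq_singleton_of_leafS {f : E₁} (hl : LeafS Z₁ st x f) : dblCompS Z₁ st x = {x} := by
  ext w
  simp only [Set.mem_singleton_iff]
  constructor
  · intro h
    unfold dblCompS at h
    rw [mem_reach_singleton] at h
    rcases Relation.ReflTransGen.cases_head h with h | ⟨c, ⟨e, he, hd⟩, _⟩
    · exact h.symm
    · exfalso
      have ht := touches_of_joins Z₁ x he
      by_cases hef : e = f
      · subst hef; exact hl.1 hd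
      · have := hl.2 e ht hef
        rw [this] at hd
        exact EStat.noConfusion hd
  · rintro rfl
    exact mem_reach_self _ _

/-- A `LeafS` is a `LeafCompS`. -/
theorem leafCompS_of_leafS {f : E₁} (hl : LeafS Z₁ st x f) : LeafCompS Z₁ st x f := by
  refine ⟨hl.1, fun e he hef => Or.inl ?_⟩
  rw [dblComp_eq_singleton_of_leafS Z₁ st x hl] at he
  simp only [Set.mem_singleton_iff] at he
  exact hl.2 e he hef

end MultiExit

end ZoneZ

end PercRepro
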